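import Mathlib

/-!
# `OrbitDimensionBound` (stmt-ValiantsHypothesis-16133), rung line `square_covering` — stub `stub_stableReduction`,
# part A: the lattice of balanced sub-pencils, its atoms, and the socle dichotomy

Helper file (part A of four) for stub 1 `stub_stableReduction` of
`Cruxes/OrbitDimensionBound/Lines/square_covering.lean` (route `FreeSubtorus`, rung `Power.SquareShadow`).  The stub asks:
an equivariant affine determinantal representation of `per_n ^ k` contains a BLOCK-INDECOMPOSABLE equivariant affine
representation of some `per_n ^ j`, `1 ≤ j ≤ k`.  The registered docstring suggests Borel's fixed point theorem; we give
a Borel-free proof through King's abelian category of `θ`-semistable pencils, of which this file is the lattice-theoretic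
core, stated for an arbitrary family of linear maps `F i : E → E'` between finite-dimensional vector spaces (the
coefficient matrices of the pencil).

Vocabulary (all INLINE, no definitions are introduced).  For a subspace `V ≤ E` write `W(V) := ⨆ i, (F i) '' V ≤ E'`, the
least `W` with `F i (V) ⊆ W` for all `i` (so the sub-pencils with source `V` are the pairs `(V, W)` with `W ⊇ W(V)`).
SEMISTABILITY of the pencil is the hypothesis `hss : ∀ V, dim V ≤ dim W(V)` (for a square pencil with `det ≠ 0` this is
the easy half of Frobenius–König, proved in part B from the tree's `det_eq_zero_of_subpencil`).  `V` is BALANCED if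
`dim W(V) ≤ dim V` (then `(V, W(V))` is an equal-dimension sub-pencil, i.e. a subobject in King's category of
`θ`-semistable representations, `θ = (-1, 1)`), and an ATOM if it is a minimal non-zero balanced subspace (a `θ`-STABLE
subobject).  Contents:

* `balanced_inf`, `balanced_sup`, `balanced_finsetSup` — balanced subspaces form a sublattice (modularity of `dim`);
* `exists_atom_le` — every non-zero balanced subspace contains an atom;
* `isInternal_of_iSup_eq_top_of_sum_finrank_eq` — a finite family spanning `E` with `∑ dim = dim E` is an internal direct
  sum;
* **`invariant_or_semisimple`** (the SOCLE DICHOTOMY) — for a semistable pencil with `dim E = dim E' > 0` and any set `Φ`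
  of pairs of automorphisms `(h, g)` compatible with the pencil (`F i ∘ h` and `g ∘ F i` have the same image of every
  subspace — this is what an exact lift `B(γ·x) = g B(x) h⁻¹` of a diagonal substitution does to the coefficient
  matrices), EITHER there is a proper non-zero balanced subspace `V` with `h V = V` and `g W(V) = W(V)` for all
  `(h, g) ∈ Φ` (the socle, when it is proper), OR `E` is the internal direct sum of finitely many atoms and `E'` the
  internal direct sum of their `W`'s (the pencil is "semisimple").  The socle is realised as the span of a maximal
  direct family of atoms, which avoids suprema over infinite sets.

Parts B–D (separate files) turn case 1 into a two-block split of the matrix and case 2 into a block-diagonal form with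
stable blocks whose isomorphism types are permuted by the torus.

Helper mode (`--supports stmt-ValiantsHypothesis-16133 --as helper`).  Honest framing: [folklore] linear algebra toward
ONE registered stub (`stub_stableReduction`, M) of a dormant rung line whose load-bearing stub `stub_gradedPowerCount` is
OPEN; the crux `OrbitDimensionBound`, the route `FreeSubtorus` and VP ≠ VNP are OPEN and are not moved by this file.

## References (orientation only; nothing is cited as a named fact)
* A. D. King, *Moduli of representations of finite-dimensional algebras*, Quart. J. Math. 45 (1994), §3 (the abelian
  category of `θ`-semistables; `θ`-stable = simple).
* [LandsbergRessayre2017] J. M. Landsberg, N. Ressayre, Differential Geom. Appl. 55 (2017), §3, §6.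
-/

set_option linter.dupNamespace false

namespace Summit.ValiantsHypothesis.ValiantsHypothesis.Theorems.FreeSubtorusOrbitDimensionBound.SquareCovering.StableReduction

open Module Submodule

variable {K : Type*} [Field K] {E E' : Type*} [AddCommGroup E] [Module K E] [AddCommGroup E'] [Module K E']
  {ι : Type*} (F : ι → E →ₗ[K] E')

/-! ### §1 The operator `V ↦ W(V) = ⨆ i, F i (V)` -/

section Operator

/-- `W(·)` is monotone. [folklore] -/
theorem iSup_map_mono {V V' : Submodule K E} (h : V ≤ V') : (⨆ i, V.map (F i)) ≤ ⨆ i, V'.map (F i) :=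
  iSup_mono fun _ => Submodule.map_mono h

/-- `W(V ⊔ V') = W(V) ⊔ W(V')`. [folklore] -/
theorem iSup_map_sup (V V' : Submodule K E) :
    (⨆ i, (V ⊔ V').map (F i)) = (⨆ i, V.map (F i)) ⊔ ⨆ i, V'.map (F i) := by
  simp only [Submodule.map_sup]
  exact iSup_sup_eq

/-- `W(V ⊓ V') ≤ W(V) ⊓ W(V')`. [folklore] -/
theorem iSup_map_inf_le (V V' : Submodule K E) :
    (⨆ i, (V ⊓ V').map (F i)) ≤ (⨆ i, V.map (F i)) ⊓ ⨆ i, V'.map (F i) :=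
  le_inf (iSup_map_mono F inf_le_left) (iSup_map_mono F inf_le_right)

/-- `W(⊥) = ⊥`. [folklore] -/
theorem iSup_map_bot : (⨆ i, (⊥ : Submodule K E).map (F i)) = ⊥ := by
  simp only [Submodule.map_bot, iSup_bot]

/-- `W` of a finite supremum is the finite supremum of the `W`'s. [folklore] -/
theorem iSup_map_finsetSup (T : Finset (Submodule K E)) :
    (⨆ i, (T.sup id).map (F i)) = T.sup fun A => ⨆ i, A.map (F i) := by
  classical
  induction T using Finset.induction_on with
  | empty => simp only [Finset.sup_empty]; exact iSup_map_bot F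
  | insert A T hA ih => rw [Finset.sup_insert, Finset.sup_insert, id, iSup_map_sup, ih]

/-- `W` commutes with a compatible pair of automorphisms: if `F i ∘ h` and `g ∘ F i` have the same images then
`W(h V) = g W(V)`. [folklore] -/
theorem iSup_map_map_eq (h : E ≃ₗ[K] E) (g : E' ≃ₗ[K] E')
    (hcomp : ∀ i (V : Submodule K E), (V.map (h : E →ₗ[K] E)).map (F i) = (V.map (F i)).map (g : E' →ₗ[K] E'))
    (V : Submodule K E) :
    (⨆ i, (V.map (h : E →ₗ[K] E)).map (F i)) = (⨆ i, V.map (F i)).map (g : E' →ₗ[K] E') := by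
  rw [Submodule.map_iSup]
  exact iSup_congr fun i => hcomp i V

/-- A balanced subspace is mapped to a balanced subspace by a compatible pair of automorphisms. [folklore] -/
theorem balanced_map (h : E ≃ₗ[K] E) (g : E' ≃ₗ[K] E')
    (hcomp : ∀ i (V : Submodule K E), (V.map (h : E →ₗ[K] E)).map (F i) = (V.map (F i)).map (g : E' →ₗ[K] E'))
    {V : Submodule K E} (hV : finrank K ↥(⨆ i, V.map (F i)) ≤ finrank K V) :
    finrank K ↥(⨆ i, (V.map (h : E →ₗ[K] E)).map (F i)) ≤ finrank K ↥(V.map (h : E →ₗ[K] E)) := by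
  rw [iSup_map_map_eq F h g hcomp, LinearEquiv.finrank_map_eq, LinearEquiv.finrank_map_eq]
  exact hV

/-- Compatibility of `(h, g)` passes to the inverse pair `(h⁻¹, g⁻¹)`. [folklore] -/
theorem compat_symm (h : E ≃ₗ[K] E) (g : E' ≃ₗ[K] E')
    (hcomp : ∀ i (V : Submodule K E), (V.map (h : E →ₗ[K] E)).map (F i) = (V.map (F i)).map (g : E' →ₗ[K] E'))
    (i : ι) (V : Submodule K E) :
    (V.map (h.symm : E →ₗ[K] E)).map (F i) = (V.map (F i)).map (g.symm : E' →ₗ[K] E') := by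
  have hid : ((h : E →ₗ[K] E).comp (h.symm : E →ₗ[K] E)) = LinearMap.id := by
    ext x; simp
  have hid' : ((g.symm : E' →ₗ[K] E').comp (g : E' →ₗ[K] E')) = LinearMap.id := by
    ext x; simp
  have h2 : (V.map (h.symm : E →ₗ[K] E)).map (h : E →ₗ[K] E) = V := by
    rw [← Submodule.map_comp, hid, Submodule.map_id]
  have h3 : ∀ X : Submodule K E', (X.map (g : E' →ₗ[K] E')).map (g.symm : E' →ₗ[K] E') = X := fun X => by
    rw [← Submodule.map_comp, hid', Submodule.map_id]
  have h1 := hcomp i (V.map (h.symm : E →ₗ[K] E))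
  rw [h2] at h1
  rw [h1, h3]

end Operator

/-! ### §2 Balanced subspaces form a lattice -/

section Balanced

variable [FiniteDimensional K E] [FiniteDimensional K E']

/-- **Balanced ⊓ balanced is balanced** (modularity of dimension: `dim W(V) + dim W(V') ≤ dim V + dim V'`,
`dim (V ⊔ V') ≤ dim (W(V) ⊔ W(V'))`, `W(V ⊓ V') ≤ W(V) ⊓ W(V')`). [folklore] -/
theorem balanced_inf (hss : ∀ V : Submodule K E, finrank K V ≤ finrank K ↥(⨆ i, V.map (F i)))
    {V V' : Submodule K E} (hV : finrank K ↥(⨆ i, V.map (F i)) ≤ finrank K V)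
    (hV' : finrank K ↥(⨆ i, V'.map (F i)) ≤ finrank K V') :
    finrank K ↥(⨆ i, (V ⊓ V').map (F i)) ≤ finrank K ↥(V ⊓ V') := by
  have h1 : finrank K ↥(V ⊔ V') ≤ finrank K ↥((⨆ i, V.map (F i)) ⊔ ⨆ i, V'.map (F i)) := by
    rw [← iSup_map_sup]; exact hss _
  have h2 := Submodule.finrank_sup_add_finrank_inf_eq V V'
  have h3 := Submodule.finrank_sup_add_finrank_inf_eq (⨆ i, V.map (F i)) (⨆ i, V'.map (F i))
  have h4 : finrank K ↥(⨆ i, (V ⊓ V').map (F i)) ≤ finrank K ↥((⨆ i, V.map (F i)) ⊓ ⨆ i, V'.map (F i)) :=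
    Submodule.finrank_mono (iSup_map_inf_le F V V')
  omega

/-- **Balanced ⊔ balanced is balanced.** [folklore] -/
theorem balanced_sup (hss : ∀ V : Submodule K E, finrank K V ≤ finrank K ↥(⨆ i, V.map (F i)))
    {V V' : Submodule K E} (hV : finrank K ↥(⨆ i, V.map (F i)) ≤ finrank K V)
    (hV' : finrank K ↥(⨆ i, V'.map (F i)) ≤ finrank K V') :
    finrank K ↥(⨆ i, (V ⊔ V').map (F i)) ≤ finrank K ↥(V ⊔ V') := by
  have h1 : finrank K ↥(V ⊓ V') ≤ finrank K ↥((⨆ i, V.map (F i)) ⊓ ⨆ i, V'.map (F i)) :=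
    (hss _).trans (Submodule.finrank_mono (iSup_map_inf_le F V V'))
  have h2 := Submodule.finrank_sup_add_finrank_inf_eq V V'
  have h3 := Submodule.finrank_sup_add_finrank_inf_eq (⨆ i, V.map (F i)) (⨆ i, V'.map (F i))
  rw [iSup_map_sup]
  omega

/-- A finite supremum of balanced subspaces is balanced. [folklore] -/
theorem balanced_finsetSup (hss : ∀ V : Submodule K E, finrank K V ≤ finrank K ↥(⨆ i, V.map (F i)))
    (T : Finset (Submodule K E)) (hT : ∀ A ∈ T, finrank K ↥(⨆ i, A.map (F i)) ≤ finrank K A) :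
    finrank K ↥(⨆ i, (T.sup id).map (F i)) ≤ finrank K ↥(T.sup id) := by
  classical
  induction T using Finset.induction_on with
  | empty => exact le_of_eq (by rw [Finset.sup_empty, iSup_map_bot, finrank_bot, finrank_bot])
  | insert A T hA ih =>
    rw [Finset.sup_insert, id]
    exact balanced_sup F hss (hT A (Finset.mem_insert_self A T)) (ih fun A' hA' => hT A' (Finset.mem_insert_of_mem hA'))



/-! ### §3 Atoms -/

omit [FiniteDimensional K E'] in
/-- Every non-zero balanced subspace contains an ATOM — a minimal non-zero balanced subspace (minimise the
dimension). [folklore] -/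
theorem exists_atom_le {V : Submodule K E} (hV0 : V ≠ ⊥) (hV : finrank K ↥(⨆ i, V.map (F i)) ≤ finrank K V) :
    ∃ A : Submodule K E, A ≤ V ∧ A ≠ ⊥ ∧ finrank K ↥(⨆ i, A.map (F i)) ≤ finrank K A ∧
      ∀ A' : Submodule K E, A' ≤ A → A' ≠ ⊥ → finrank K ↥(⨆ i, A'.map (F i)) ≤ finrank K A' → A' = A := by
  classical
  have hex : ∃ d, ∃ A : Submodule K E, A ≤ V ∧ A ≠ ⊥ ∧ finrank K ↥(⨆ i, A.map (F i)) ≤ finrank K A ∧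
      finrank K A = d := ⟨_, V, le_rfl, hV0, hV, rfl⟩
  obtain ⟨A, hAV, hA0, hA, hAd⟩ := Nat.find_spec hex
  refine ⟨A, hAV, hA0, hA, fun A' hA'A hA'0 hA' => ?_⟩
  have hmin : Nat.find hex ≤ finrank K A' := Nat.find_min' hex ⟨A', hA'A.trans hAV, hA'0, hA', rfl⟩
  exact Submodule.eq_of_le_of_finrank_le hA'A (by omega)

omit [FiniteDimensional K E] [FiniteDimensional K E'] in
/-- A compatible pair of automorphisms maps atoms to atoms. [folklore] -/
theorem atom_map (h : E ≃ₗ[K] E) (g : E' ≃ₗ[K] E')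
    (hcomp : ∀ i (V : Submodule K E), (V.map (h : E →ₗ[K] E)).map (F i) = (V.map (F i)).map (g : E' →ₗ[K] E'))
    {A : Submodule K E} (hA0 : A ≠ ⊥) (hA : finrank K ↥(⨆ i, A.map (F i)) ≤ finrank K A)
    (hAmin : ∀ A' : Submodule K E, A' ≤ A → A' ≠ ⊥ → finrank K ↥(⨆ i, A'.map (F i)) ≤ finrank K A' → A' = A) :
    A.map (h : E →ₗ[K] E) ≠ ⊥ ∧
      finrank K ↥(⨆ i, (A.map (h : E →ₗ[K] E)).map (F i)) ≤ finrank K ↥(A.map (h : E →ₗ[K] E)) ∧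
      ∀ A' : Submodule K E, A' ≤ A.map (h : E →ₗ[K] E) → A' ≠ ⊥ →
        finrank K ↥(⨆ i, A'.map (F i)) ≤ finrank K A' → A' = A.map (h : E →ₗ[K] E) := by
  have hmap : ∀ (X : Submodule K E), (X.map (h : E →ₗ[K] E)).map (h.symm : E →ₗ[K] E) = X := fun X => by
    rw [← Submodule.map_comp]
    have : ((h.symm : E →ₗ[K] E).comp (h : E →ₗ[K] E)) = LinearMap.id := by ext x; simp
    rw [this, Submodule.map_id]
  have hmap' : ∀ (X : Submodule K E), (X.map (h.symm : E →ₗ[K] E)).map (h : E →ₗ[K] E) = X := fun X => by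
    rw [← Submodule.map_comp]
    have : ((h : E →ₗ[K] E).comp (h.symm : E →ₗ[K] E)) = LinearMap.id := by ext x; simp
    rw [this, Submodule.map_id]
  refine ⟨?_, balanced_map F h g hcomp hA, fun A' hA'le hA'0 hA' => ?_⟩
  · intro h0
    apply hA0
    have := congrArg (Submodule.map (h.symm : E →ₗ[K] E)) h0
    rwa [hmap, Submodule.map_bot] at this
  · have h1 : A'.map (h.symm : E →ₗ[K] E) ≤ A := by
      have := Submodule.map_mono (f := (h.symm : E →ₗ[K] E)) hA'le
      rwa [hmap] at this
    have h2 : A'.map (h.symm : E →ₗ[K] E) ≠ ⊥ := by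
      intro h0
      apply hA'0
      have := congrArg (Submodule.map (h : E →ₗ[K] E)) h0
      rwa [hmap', Submodule.map_bot] at this
    have h3 := hAmin _ h1 h2 (balanced_map F h.symm g.symm (compat_symm F h g hcomp) hA')
    rw [← h3, hmap']

/-! ### §4 Internal direct sums from a dimension count -/

omit [FiniteDimensional K E'] in
/-- A finite family of subspaces spanning `E` whose dimensions add up to `dim E` is an internal direct sum (the
summation map from the external direct sum is surjective between spaces of equal dimension). [folklore] -/
theorem isInternal_of_iSup_eq_top_of_sum_finrank_eq {κ : Type*} [Fintype κ] [DecidableEq κ]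
    (A : κ → Submodule K E) (htop : ⨆ j, A j = ⊤) (hsum : ∑ j, finrank K (A j) = finrank K E) :
    DirectSum.IsInternal A := by
  have hsurj : Function.Surjective (DirectSum.coeLinearMap A) := by
    rw [← LinearMap.range_eq_top, DirectSum.range_coeLinearMap, htop]
  refine ⟨?_, hsurj⟩
  have hfin : finrank K (DirectSum κ fun j => ↥(A j)) = finrank K E := by
    rw [Module.finrank_directSum, hsum]
  exact (LinearMap.injective_iff_surjective_of_finrank_eq_finrank hfin).2 hsurj

/-! ### §5 The socle dichotomy -/

/-- **Socle dichotomy.**  Let the pencil `F` be semistable (`dim V ≤ dim W(V)` for all `V`) with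
`dim E = dim E' > 0`, and let `Φ` be a set of pairs of automorphisms `(h, g)` compatible with `F`.  Then EITHER some
proper non-zero balanced subspace `V` is invariant (`h V = V`, `g W(V) = W(V)` for all `(h, g) ∈ Φ`), OR `E` is the
internal direct sum of a finite set of atoms and `E'` the internal direct sum of their `W`'s.  (The span `S` of a
maximal direct family of atoms contains every atom, hence is `Φ`-invariant; the two cases are `S ≠ E` and `S = E`.)
[folklore] -/
theorem invariant_or_semisimple (hss : ∀ V : Submodule K E, finrank K V ≤ finrank K ↥(⨆ i, V.map (F i)))
    (hEE' : finrank K E' = finrank K E) (hE : 0 < finrank K E)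
    (Φ : Set ((E ≃ₗ[K] E) × (E' ≃ₗ[K] E')))
    (hΦ : ∀ p ∈ Φ, ∀ i (V : Submodule K E),
      (V.map (p.1 : E →ₗ[K] E)).map (F i) = (V.map (F i)).map (p.2 : E' →ₗ[K] E')) :
    (∃ V : Submodule K E, V ≠ ⊥ ∧ V ≠ ⊤ ∧ finrank K ↥(⨆ i, V.map (F i)) ≤ finrank K V ∧
        ∀ p ∈ Φ, V.map (p.1 : E →ₗ[K] E) = V ∧
          (⨆ i, V.map (F i)).map (p.2 : E' →ₗ[K] E') = ⨆ i, V.map (F i)) ∨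
    (∃ T : Finset (Submodule K E),
        (∀ A ∈ T, A ≠ ⊥ ∧ finrank K ↥(⨆ i, A.map (F i)) ≤ finrank K A ∧
          ∀ A' : Submodule K E, A' ≤ A → A' ≠ ⊥ → finrank K ↥(⨆ i, A'.map (F i)) ≤ finrank K A' → A' = A) ∧
        DirectSum.IsInternal (fun A : T => (A : Submodule K E)) ∧
        DirectSum.IsInternal (fun A : T => ⨆ i, (A : Submodule K E).map (F i))) := by
  classical
  -- `P N`: there is a DIRECT family of `N` atoms (dimensions add up)
  let P : ℕ → Prop := fun N => ∃ T : Finset (Submodule K E), T.card = N ∧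
      (∀ A ∈ T, A ≠ ⊥ ∧ finrank K ↥(⨆ i, A.map (F i)) ≤ finrank K A ∧
        ∀ A' : Submodule K E, A' ≤ A → A' ≠ ⊥ → finrank K ↥(⨆ i, A'.map (F i)) ≤ finrank K A' → A' = A) ∧
      ∑ A ∈ T, finrank K A = finrank K ↥(T.sup id)
  have hP0 : P 0 := ⟨∅, rfl, by simp, by rw [Finset.sum_empty, Finset.sup_empty, finrank_bot]⟩
  have hbound : ∀ N, P N → N ≤ finrank K E := by
    rintro N ⟨T, rfl, hT, hsum⟩
    have h1 : ∀ A ∈ T, 1 ≤ finrank K A := fun A hA => by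
      rw [Nat.one_le_iff_ne_zero, Ne, Submodule.finrank_eq_zero]
      exact (hT A hA).1
    calc T.card = ∑ A ∈ T, 1 := by simp
      _ ≤ ∑ A ∈ T, finrank K A := Finset.sum_le_sum h1
      _ = finrank K ↥(T.sup id) := hsum
      _ ≤ finrank K E := Submodule.finrank_le _
  obtain ⟨T, hTcard, hT, hsum⟩ : P (Nat.findGreatest P (finrank K E)) := Nat.findGreatest_spec (Nat.zero_le _) hP0
  set S : Submodule K E := T.sup id with hSdef
  have hSbal : finrank K ↥(⨆ i, S.map (F i)) ≤ finrank K S :=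
    balanced_finsetSup F hss T fun A hA => (hT A hA).2.1
  -- every atom lies in `S` (maximality of the direct family)
  have key : ∀ A : Submodule K E, A ≠ ⊥ → finrank K ↥(⨆ i, A.map (F i)) ≤ finrank K A →
      (∀ A' : Submodule K E, A' ≤ A → A' ≠ ⊥ → finrank K ↥(⨆ i, A'.map (F i)) ≤ finrank K A' → A' = A) →
      A ≤ S := by
    intro A hA0 hA hAmin
    by_contra hAS
    have hinf : A ⊓ S = ⊥ := by
      by_contra hne
      have h1 := hAmin (A ⊓ S) inf_le_left hne (balanced_inf F hss hA hSbal)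
      exact hAS (h1 ▸ inf_le_right)
    have hAT : A ∉ T := fun h => hAS (Finset.le_sup (f := id) h)
    have hP' : P (Nat.findGreatest P (finrank K E) + 1) := by
      refine ⟨insert A T, by rw [Finset.card_insert_of_notMem hAT, hTcard], fun A' hA' => ?_, ?_⟩
      · rcases Finset.mem_insert.1 hA' with rfl | h
        · exact ⟨hA0, hA, hAmin⟩
        · exact hT A' h
      · rw [Finset.sum_insert hAT, Finset.sup_insert, id, hsum, ← hSdef]
        have := Submodule.finrank_sup_add_finrank_inf_eq A S
        rw [hinf, finrank_bot] at this
        omega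
    exact Nat.findGreatest_is_greatest (lt_add_one _) (hbound _ hP') hP'
  -- `S` is `Φ`-invariant
  have hmapS : ∀ p ∈ Φ, S.map (p.1 : E →ₗ[K] E) = S := by
    intro p hp
    refine Submodule.eq_of_le_of_finrank_eq ?_ (LinearEquiv.finrank_map_eq _ _)
    rw [hSdef, Finset.apply_sup_eq_sup_comp (Submodule.map (p.1 : E →ₗ[K] E)) (fun x y => Submodule.map_sup _ _ _)
      (Submodule.map_bot _)]
    refine Finset.sup_le fun A hA => ?_
    obtain ⟨h1, h2, h3⟩ := atom_map F p.1 p.2 (hΦ p hp) (hT A hA).1 (hT A hA).2.1 (hT A hA).2.2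
    exact key _ h1 h2 h3
  have hmapW : ∀ p ∈ Φ, (⨆ i, S.map (F i)).map (p.2 : E' →ₗ[K] E') = ⨆ i, S.map (F i) := by
    intro p hp
    rw [← iSup_map_map_eq F p.1 p.2 (hΦ p hp), hmapS p hp]
  by_cases hStop : S = ⊤
  · -- semisimple case
    right
    have hiSup : (⨆ A : T, (A : Submodule K E)) = ⊤ := by
      rw [← hStop, hSdef, Finset.sup_id_eq_sSup, sSup_eq_iSup']
      rfl
    have hsum' : ∑ A : T, finrank K (A : Submodule K E) = finrank K E := by
      rw [Finset.sum_coe_sort T fun A => finrank K A, hsum, hStop, finrank_top]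
    refine ⟨T, hT, isInternal_of_iSup_eq_top_of_sum_finrank_eq _ hiSup hsum', ?_⟩
    refine isInternal_of_iSup_eq_top_of_sum_finrank_eq _ ?_ ?_
    · -- `⨆_A W(A) = W(⊤) = ⊤`
      have h1 : (⨆ A : T, ⨆ i, (A : Submodule K E).map (F i)) = ⨆ i, (⊤ : Submodule K E).map (F i) := by
        rw [iSup_comm, ← hiSup]
        exact iSup_congr fun i => (Submodule.map_iSup _ _).symm
      rw [h1]
      refine Submodule.eq_top_of_finrank_eq ?_
      refine le_antisymm (Submodule.finrank_le _) ?_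
      rw [hEE', ← finrank_top K E]
      exact hss ⊤
    · calc ∑ A : T, finrank K ↥(⨆ i, (A : Submodule K E).map (F i))
          = ∑ A : T, finrank K (A : Submodule K E) :=
            Finset.sum_congr rfl fun A _ => le_antisymm (hT A A.2).2.1 (hss _)
        _ = finrank K E' := by rw [hsum', hEE']
  · -- invariant proper socle
    left
    refine ⟨S, ?_, hStop, hSbal, fun p hp => ⟨hmapS p hp, hmapW p hp⟩⟩
    -- `S ≠ ⊥`: it contains an atom
    have htop0 : (⊤ : Submodule K E) ≠ ⊥ := by
      intro h0
      rw [← finrank_top K E, h0, finrank_bot] at hE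
      exact lt_irrefl 0 hE
    have htopbal : finrank K ↥(⨆ i, (⊤ : Submodule K E).map (F i)) ≤ finrank K (⊤ : Submodule K E) := by
      rw [finrank_top, ← hEE']
      exact Submodule.finrank_le _
    obtain ⟨A₀, -, hA0, hA, hAmin⟩ := exists_atom_le F htop0 htopbal
    intro hS0
    exact hA0 (le_bot_iff.1 (hS0 ▸ key A₀ hA0 hA hAmin))

end Balanced

end Summit.ValiantsHypothesis.ValiantsHypothesis.Theorems.FreeSubtorusOrbitDimensionBound.SquareCovering.StableReduction
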